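import Mathlib

/-!
# Rate arithmetic (helpers for stub `stub_scaleRegularity`)

Pure real-variable bookkeeping for the scale-regularity stub of line `self-energy-pick-inversion`
(crux stmt-CriticalPhenomena-4799).  Given a family `Φ : ℕ → (ℤ² → ℝ)` with "slab sums" `S : ℕ → ℝ`
obeying the three GAP MOMENT BOUNDS (outputs (F0)–(F2) of the profile-family file, taken here as
hypotheses, with `A = 16/c₀²`, `A' = 128/c₀³`, `P = (2π)⁻²`)

* (F0) `|Φ (m+d) y| ≤ P · S(m) · A/d²`,
* (F1) `|Φ (m+d) y − Φ (m+d) y'| ≤ D(y,y') · P · S(m) · A'/d³`,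
* (F2) `|Φ (m+d+u) y − Φ (m+d+u+1) y| ≤ P · (S(m)/(u+1)) · A/d²`,

and the radial upper bound `S(m) m^p ≤ B` for `m ≥ N₁` (`0 ≤ p ≤ 3`), the choices `m = n/2, d = n − m`
(resp. `q = n/4`, `m = n − 2q`, `d = u = q`) give the RATES

* `|Φ n y| n^{p+2} ≤ 108 P A B`, `|Φ n y − Φ n y'| n^{p+3} ≤ 216 P A' B · D(y,y')`,
  `|Φ n y − Φ (n+1) y| n^{p+3} ≤ 2048 P A B` for `n ≥ 2N₁ + 4`.

Also: the elementary `| r^{p'} − s^{p'} | ≤ 31 δ r^{p'}` for `|r − s| ≤ δ r`, `δ ≤ 1/2`, `0 ≤ p' ≤ 5`.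
Pure theorem file, no definitions, Mathlib only.
-/

noncomputable section

namespace Summit.CriticalPhenomena.Ising3DConformalLimit.Cruxes.DirectCorrelationStableTail.SelfEnergyPickInversion

open Real
open scoped BigOperators

/-! ### Elementary power estimates -/

/-- `n^p ≤ 27 m^p` when `n ≤ 3m`, `0 ≤ p ≤ 3`. -/
theorem rpow_le_27_mul {n m p : ℝ} (hn : 0 ≤ n) (hm : 0 ≤ m) (hnm : n ≤ 3 * m) (hp0 : 0 ≤ p)
    (hp3 : p ≤ 3) : n ^ p ≤ 27 * m ^ p := by
  have h3 : (3 : ℝ) ^ p ≤ 27 := by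
    calc (3 : ℝ) ^ p ≤ (3 : ℝ) ^ (3 : ℝ) := Real.rpow_le_rpow_of_exponent_le (by norm_num) hp3
      _ = 27 := by norm_num
  calc n ^ p ≤ (3 * m) ^ p := Real.rpow_le_rpow hn hnm hp0
    _ = 3 ^ p * m ^ p := Real.mul_rpow (by norm_num) hm
    _ ≤ 27 * m ^ p := mul_le_mul_of_nonneg_right h3 (Real.rpow_nonneg hm p)

/-- `n^p ≤ 8 m^p` when `n ≤ 2m`, `0 ≤ p ≤ 3`. -/
theorem rpow_le_8_mul {n m p : ℝ} (hn : 0 ≤ n) (hm : 0 ≤ m) (hnm : n ≤ 2 * m) (hp0 : 0 ≤ p)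
    (hp3 : p ≤ 3) : n ^ p ≤ 8 * m ^ p := by
  have h2 : (2 : ℝ) ^ p ≤ 8 := by
    calc (2 : ℝ) ^ p ≤ (2 : ℝ) ^ (3 : ℝ) := Real.rpow_le_rpow_of_exponent_le (by norm_num) hp3
      _ = 8 := by norm_num
  calc n ^ p ≤ (2 * m) ^ p := Real.rpow_le_rpow hn hnm hp0
    _ = 2 ^ p * m ^ p := Real.mul_rpow (by norm_num) hm
    _ ≤ 8 * m ^ p := mul_le_mul_of_nonneg_right h2 (Real.rpow_nonneg hm p)

/-! ### The three rates -/

/-- **Axial rate** from (F0): `|Φ n y| n^{p+2} ≤ 108 P A B` for `n ≥ 2N₁ + 2`. -/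
theorem rate_axial {Φ : ℕ → (Fin 2 → ℤ) → ℝ} {S : ℕ → ℝ} {P A B p : ℝ} (hP : 0 ≤ P) (hA : 0 ≤ A)
    (hp0 : 0 ≤ p) (hp3 : p ≤ 3) (hS : ∀ m, 1 ≤ m → 0 ≤ S m) {N₁ : ℕ}
    (hup : ∀ m, N₁ ≤ m → 1 ≤ m → S m * (m : ℝ) ^ p ≤ B)
    (hF0 : ∀ m d : ℕ, 1 ≤ m → 1 ≤ d → ∀ y, |Φ (m + d) y| ≤ P * (S m * (A / (d : ℝ) ^ 2)))
    {n : ℕ} (hn : 2 * N₁ + 2 ≤ n) (y : Fin 2 → ℤ) :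
    |Φ n y| * (n : ℝ) ^ (p + 2) ≤ 108 * P * A * B := by
  obtain ⟨m, hm⟩ : ∃ m, m = n / 2 := ⟨_, rfl⟩
  obtain ⟨d, hd⟩ : ∃ d, d = n - m := ⟨_, rfl⟩
  have hmd : m + d = n := by omega
  have hm1 : 1 ≤ m := by omega
  have hmN : N₁ ≤ m := by omega
  have hd1 : 1 ≤ d := by omega
  have h3 : (n : ℝ) ≤ 3 * m := by exact_mod_cast (show n ≤ 3 * m by omega)
  have h2 : (n : ℝ) ≤ 2 * d := by exact_mod_cast (show n ≤ 2 * d by omega)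
  have hn0 : (0 : ℝ) < n := by exact_mod_cast (show 0 < n by omega)
  have hd0 : (0 : ℝ) < d := by exact_mod_cast (show 0 < d by omega)
  have key := hF0 m d hm1 hd1 y
  rw [hmd] at key
  have hSm := hS m hm1
  have hB := hup m hmN hm1
  have hnp : (n : ℝ) ^ p ≤ 27 * (m : ℝ) ^ p := rpow_le_27_mul hn0.le (Nat.cast_nonneg m) h3 hp0 hp3
  have hn2 : (n : ℝ) ^ 2 ≤ 4 * (d : ℝ) ^ 2 := by nlinarith
  calc |Φ n y| * (n : ℝ) ^ (p + 2) = |Φ n y| * ((n : ℝ) ^ p * (n : ℝ) ^ 2) := by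
        rw [Real.rpow_add hn0, Real.rpow_two]
    _ ≤ (P * (S m * (A / (d : ℝ) ^ 2))) * ((27 * (m : ℝ) ^ p) * (4 * (d : ℝ) ^ 2)) :=
        mul_le_mul key (mul_le_mul hnp hn2 (by positivity) (by positivity)) (by positivity)
          (by positivity)
    _ = 108 * P * A * (S m * (m : ℝ) ^ p) := by
        field_simp
        ring
    _ ≤ 108 * P * A * B := by gcongr

/-- **Transverse rate** from (F1): `|Φ n y − Φ n y'| n^{p+3} ≤ 216 P A' B · D(y,y')` for `n ≥ 2N₁ + 2`. -/
theorem rate_transverse {Φ : ℕ → (Fin 2 → ℤ) → ℝ} {S : ℕ → ℝ} {D : (Fin 2 → ℤ) → (Fin 2 → ℤ) → ℝ}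
    {P A B p : ℝ} (hP : 0 ≤ P) (hA : 0 ≤ A) (hp0 : 0 ≤ p) (hp3 : p ≤ 3)
    (hS : ∀ m, 1 ≤ m → 0 ≤ S m) (hD : ∀ y y', 0 ≤ D y y') {N₁ : ℕ}
    (hup : ∀ m, N₁ ≤ m → 1 ≤ m → S m * (m : ℝ) ^ p ≤ B)
    (hF1 : ∀ m d : ℕ, 1 ≤ m → 1 ≤ d → ∀ y y',
      |Φ (m + d) y - Φ (m + d) y'| ≤ D y y' * (P * (S m * (A / (d : ℝ) ^ 3))))
    {n : ℕ} (hn : 2 * N₁ + 2 ≤ n) (y y' : Fin 2 → ℤ) :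
    |Φ n y - Φ n y'| * (n : ℝ) ^ (p + 3) ≤ 216 * P * A * B * D y y' := by
  obtain ⟨m, hm⟩ : ∃ m, m = n / 2 := ⟨_, rfl⟩
  obtain ⟨d, hd⟩ : ∃ d, d = n - m := ⟨_, rfl⟩
  have hmd : m + d = n := by omega
  have hm1 : 1 ≤ m := by omega
  have hmN : N₁ ≤ m := by omega
  have hd1 : 1 ≤ d := by omega
  have h3 : (n : ℝ) ≤ 3 * m := by exact_mod_cast (show n ≤ 3 * m by omega)
  have h2 : (n : ℝ) ≤ 2 * d := by exact_mod_cast (show n ≤ 2 * d by omega)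
  have hn0 : (0 : ℝ) < n := by exact_mod_cast (show 0 < n by omega)
  have hd0 : (0 : ℝ) < d := by exact_mod_cast (show 0 < d by omega)
  have key := hF1 m d hm1 hd1 y y'
  rw [hmd] at key
  have hSm := hS m hm1
  have hB := hup m hmN hm1
  have hDy := hD y y'
  have hnp : (n : ℝ) ^ p ≤ 27 * (m : ℝ) ^ p := rpow_le_27_mul hn0.le (Nat.cast_nonneg m) h3 hp0 hp3
  have hn3 : (n : ℝ) ^ 3 ≤ 8 * (d : ℝ) ^ 3 := by
    calc (n : ℝ) ^ 3 ≤ (2 * (d : ℝ)) ^ 3 := pow_le_pow_left₀ hn0.le h2 3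
      _ = 8 * (d : ℝ) ^ 3 := by ring
  calc |Φ n y - Φ n y'| * (n : ℝ) ^ (p + 3)
      = |Φ n y - Φ n y'| * ((n : ℝ) ^ p * (n : ℝ) ^ 3) := by
        rw [Real.rpow_add hn0, show (3 : ℝ) = ((3 : ℕ) : ℝ) by norm_num, Real.rpow_natCast]
    _ ≤ (D y y' * (P * (S m * (A / (d : ℝ) ^ 3)))) * ((27 * (m : ℝ) ^ p) * (8 * (d : ℝ) ^ 3)) :=
        mul_le_mul key (mul_le_mul hnp hn3 (by positivity) (by positivity)) (by positivity)
          (by positivity)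
    _ = 216 * P * A * (S m * (m : ℝ) ^ p) * D y y' := by
        field_simp
        ring
    _ ≤ 216 * P * A * B * D y y' := by gcongr

/-- **Longitudinal rate** from (F2): `|Φ n y − Φ (n+1) y| n^{p+3} ≤ 2048 P A B` for `n ≥ 2N₁ + 4`. -/
theorem rate_longitudinal {Φ : ℕ → (Fin 2 → ℤ) → ℝ} {S : ℕ → ℝ} {P A B p : ℝ} (hP : 0 ≤ P)
    (hA : 0 ≤ A) (hp0 : 0 ≤ p) (hp3 : p ≤ 3) (hS : ∀ m, 1 ≤ m → 0 ≤ S m) {N₁ : ℕ}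
    (hup : ∀ m, N₁ ≤ m → 1 ≤ m → S m * (m : ℝ) ^ p ≤ B)
    (hF2 : ∀ m d u : ℕ, 1 ≤ m → 1 ≤ d → ∀ y,
      |Φ (m + d + u) y - Φ (m + d + u + 1) y| ≤ P * (S m / (u + 1) * (A / (d : ℝ) ^ 2)))
    {n : ℕ} (hn : 2 * N₁ + 4 ≤ n) (y : Fin 2 → ℤ) :
    |Φ n y - Φ (n + 1) y| * (n : ℝ) ^ (p + 3) ≤ 2048 * P * A * B := by
  obtain ⟨q, hq⟩ : ∃ q, q = n / 4 := ⟨_, rfl⟩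
  obtain ⟨m, hm⟩ : ∃ m, m = n - 2 * q := ⟨_, rfl⟩
  have hmd : m + q + q = n := by omega
  have hm1 : 1 ≤ m := by omega
  have hmN : N₁ ≤ m := by omega
  have hq1 : 1 ≤ q := by omega
  have h2m : (n : ℝ) ≤ 2 * m := by exact_mod_cast (show n ≤ 2 * m by omega)
  have h8 : (n : ℝ) ≤ 8 * q := by exact_mod_cast (show n ≤ 8 * q by omega)
  have h4 : (n : ℝ) ≤ 4 * ((q : ℝ) + 1) := by exact_mod_cast (show n ≤ 4 * (q + 1) by omega)
  have hn0 : (0 : ℝ) < n := by exact_mod_cast (show 0 < n by omega)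
  have hq0 : (0 : ℝ) < q := by exact_mod_cast (show 0 < q by omega)
  have key := hF2 m q q hm1 hq1 y
  rw [hmd] at key
  have hSm := hS m hm1
  have hB := hup m hmN hm1
  have hnp : (n : ℝ) ^ p ≤ 8 * (m : ℝ) ^ p := rpow_le_8_mul hn0.le (Nat.cast_nonneg m) h2m hp0 hp3
  have hn3 : (n : ℝ) ^ 3 ≤ (4 * ((q : ℝ) + 1)) * (64 * (q : ℝ) ^ 2) := by
    have : (n : ℝ) ^ 2 ≤ 64 * (q : ℝ) ^ 2 := by nlinarith
    calc (n : ℝ) ^ 3 = n * n ^ 2 := by ring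
      _ ≤ (4 * ((q : ℝ) + 1)) * (64 * (q : ℝ) ^ 2) := mul_le_mul h4 this (by positivity) (by positivity)
  calc |Φ n y - Φ (n + 1) y| * (n : ℝ) ^ (p + 3)
      = |Φ n y - Φ (n + 1) y| * ((n : ℝ) ^ p * (n : ℝ) ^ 3) := by
        rw [Real.rpow_add hn0, show (3 : ℝ) = ((3 : ℕ) : ℝ) by norm_num, Real.rpow_natCast]
    _ ≤ (P * (S m / (q + 1) * (A / (q : ℝ) ^ 2))) *
          ((8 * (m : ℝ) ^ p) * ((4 * ((q : ℝ) + 1)) * (64 * (q : ℝ) ^ 2))) :=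
        mul_le_mul key (mul_le_mul hnp hn3 (by positivity) (by positivity)) (by positivity)
          (by positivity)
    _ = 2048 * P * A * (S m * (m : ℝ) ^ p) := by
        field_simp
        ring
    _ ≤ 2048 * P * A * B := by gcongr

/-! ### Powers of comparable lengths -/

/-- `(1 + δ)^5 ≤ 1 + 31 δ` for `0 ≤ δ ≤ 1`. -/
theorem one_add_pow_five_le {δ : ℝ} (h0 : 0 ≤ δ) (h1 : δ ≤ 1) : (1 + δ) ^ 5 ≤ 1 + 31 * δ := by
  nlinarith [pow_le_one₀ h0 h1 (n := 2), pow_le_one₀ h0 h1 (n := 3), pow_le_one₀ h0 h1 (n := 4),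
    pow_nonneg h0 2, pow_nonneg h0 3, pow_nonneg h0 4, mul_nonneg h0 (pow_nonneg h0 4)]

/-- **Powers of comparable lengths.** If `|r − s| ≤ δ r` with `0 ≤ δ ≤ 1/2` and `0 ≤ p' ≤ 5`, then
`|r^{p'} − s^{p'}| ≤ 31 δ r^{p'}`. -/
theorem abs_rpow_sub_rpow_le {r s δ p' : ℝ} (hr : 0 ≤ r) (hs : 0 ≤ s) (hδ0 : 0 ≤ δ) (hδ : δ ≤ 1 / 2)
    (hp0 : 0 ≤ p') (hp5 : p' ≤ 5) (hrs : |r - s| ≤ δ * r) :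
    |r ^ p' - s ^ p'| ≤ 31 * δ * r ^ p' := by
  have hrp : 0 ≤ r ^ p' := Real.rpow_nonneg hr p'
  obtain ⟨h1, h2⟩ := abs_le.mp hrs
  have hs_up : s ≤ (1 + δ) * r := by linarith
  have hs_lo : (1 - δ) * r ≤ s := by linarith
  -- upper bound for `s ^ p'`
  have hup : s ^ p' ≤ (1 + 31 * δ) * r ^ p' := by
    calc s ^ p' ≤ ((1 + δ) * r) ^ p' := Real.rpow_le_rpow hs hs_up hp0
      _ = (1 + δ) ^ p' * r ^ p' := Real.mul_rpow (by linarith) hr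
      _ ≤ (1 + δ) ^ (5 : ℝ) * r ^ p' :=
          mul_le_mul_of_nonneg_right (Real.rpow_le_rpow_of_exponent_le (by linarith) hp5) hrp
      _ = (1 + δ) ^ 5 * r ^ p' := by
          rw [show (5 : ℝ) = ((5 : ℕ) : ℝ) by norm_num, Real.rpow_natCast]
      _ ≤ (1 + 31 * δ) * r ^ p' :=
          mul_le_mul_of_nonneg_right (one_add_pow_five_le hδ0 (by linarith)) hrp
  -- lower bound for `s ^ p'`
  have hlo : (1 - 5 * δ) * r ^ p' ≤ s ^ p' := by
    have hb : (1 - 5 * δ) ≤ (1 - δ) ^ 5 := by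
      have := one_add_mul_le_pow (show (-2 : ℝ) ≤ -δ by linarith) 5
      push_cast at this
      linarith
    calc (1 - 5 * δ) * r ^ p' ≤ (1 - δ) ^ 5 * r ^ p' := mul_le_mul_of_nonneg_right hb hrp
      _ = (1 - δ) ^ (5 : ℝ) * r ^ p' := by
          rw [show (5 : ℝ) = ((5 : ℕ) : ℝ) by norm_num, Real.rpow_natCast]
      _ ≤ (1 - δ) ^ p' * r ^ p' :=
          mul_le_mul_of_nonneg_right
            (Real.rpow_le_rpow_of_exponent_ge (by linarith) (by linarith) hp5) hrp
      _ = ((1 - δ) * r) ^ p' := (Real.mul_rpow (by linarith) hr).symm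
      _ ≤ s ^ p' := Real.rpow_le_rpow (by nlinarith) hs_lo hp0
  rw [abs_le]
  constructor <;> nlinarith

/-- `r^{p'} ≤ 16 n^{p'}` when `r ≤ √3 n`, `0 ≤ p' ≤ 5` (since `(√3)^5 = 9√3 < 16`). -/
theorem rpow_le_16_mul {r n p' : ℝ} (hr : 0 ≤ r) (hn : 0 ≤ n) (hrn : r ≤ Real.sqrt 3 * n)
    (hp0 : 0 ≤ p') (hp5 : p' ≤ 5) : r ^ p' ≤ 16 * n ^ p' := by
  have hs0 : (0 : ℝ) ≤ Real.sqrt 3 := Real.sqrt_nonneg 3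
  have hs2 : Real.sqrt 3 ^ 2 = 3 := Real.sq_sqrt (by norm_num)
  have h1 : (1 : ℝ) ≤ Real.sqrt 3 := by nlinarith
  have h16 : Real.sqrt 3 ^ p' ≤ 16 := by
    calc Real.sqrt 3 ^ p' ≤ Real.sqrt 3 ^ (5 : ℝ) := Real.rpow_le_rpow_of_exponent_le h1 hp5
      _ = Real.sqrt 3 ^ 5 := by rw [show (5 : ℝ) = ((5 : ℕ) : ℝ) by norm_num, Real.rpow_natCast]
      _ = 9 * Real.sqrt 3 := by
          rw [show Real.sqrt 3 ^ 5 = (Real.sqrt 3 ^ 2) ^ 2 * Real.sqrt 3 by ring, hs2]; norm_num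
      _ ≤ 16 := by nlinarith [hs2]
  calc r ^ p' ≤ (Real.sqrt 3 * n) ^ p' := Real.rpow_le_rpow hr hrn hp0
    _ = Real.sqrt 3 ^ p' * n ^ p' := Real.mul_rpow hs0 hn
    _ ≤ 16 * n ^ p' := mul_le_mul_of_nonneg_right h16 (Real.rpow_nonneg hn p')

/-! ### Chaining one-step differences -/

/-- **Telescoping.** If `|f j − f (j+1)| j^q ≤ C₂` for `j ≥ N` (`q ≥ 0`), then for `N ≤ p ≤ p + t`,
`|f p − f (p + t)| ≤ t · C₂ / p^q` (`p ≥ 1`). -/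
theorem abs_sub_le_of_steps {f : ℕ → ℝ} {C₂ q : ℝ} (hq : 0 ≤ q) {N : ℕ}
    (hrate : ∀ j, N ≤ j → |f j - f (j + 1)| * (j : ℝ) ^ q ≤ C₂) {p : ℕ} (hpN : N ≤ p) (hp1 : 1 ≤ p)
    (t : ℕ) : |f p - f (p + t)| ≤ t * (C₂ / (p : ℝ) ^ q) := by
  have hp0 : (0 : ℝ) < p := by exact_mod_cast hp1
  have hstep : ∀ j, p ≤ j → |f j - f (j + 1)| ≤ C₂ / (p : ℝ) ^ q := fun j hj => by
    have hj0 : (0 : ℝ) < j := by exact_mod_cast (lt_of_lt_of_le hp1 hj)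
    have h := hrate j (le_trans hpN hj)
    have hjq : (p : ℝ) ^ q ≤ (j : ℝ) ^ q := Real.rpow_le_rpow hp0.le (by exact_mod_cast hj) hq
    rw [le_div_iff₀ (Real.rpow_pos_of_pos hp0 q)]
    calc |f j - f (j + 1)| * (p : ℝ) ^ q ≤ |f j - f (j + 1)| * (j : ℝ) ^ q :=
          mul_le_mul_of_nonneg_left hjq (abs_nonneg _)
      _ ≤ C₂ := h
  induction t with
  | zero => simp
  | succ t ih =>
    calc |f p - f (p + (t + 1))| = |(f p - f (p + t)) + (f (p + t) - f (p + t + 1))| := by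
          rw [← Nat.add_assoc]; ring_nf
      _ ≤ |f p - f (p + t)| + |f (p + t) - f (p + t + 1)| := abs_add_le _ _
      _ ≤ t * (C₂ / (p : ℝ) ^ q) + C₂ / (p : ℝ) ^ q := add_le_add ih (hstep _ (by omega))
      _ = ((t + 1 : ℕ) : ℝ) * (C₂ / (p : ℝ) ^ q) := by push_cast; ring

/-- **Longitudinal chain.** Under the same one-step rate, for `n ≥ 2N + 2` and `n ≤ 2m`:
`|f n − f m| ≤ |n − m| · 2^q C₂ / n^q` (`0 ≤ q ≤ 6` is not needed here; only `q ≥ 0`). -/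
theorem abs_sub_le_longitudinal {f : ℕ → ℝ} {C₂ q : ℝ} (hq : 0 ≤ q) {N : ℕ}
    (hrate : ∀ j, N ≤ j → |f j - f (j + 1)| * (j : ℝ) ^ q ≤ C₂) {n m : ℕ} (hn : 2 * N + 2 ≤ n)
    (hm : n ≤ 2 * m) : |f n - f m| ≤ |(n : ℝ) - m| * (2 ^ q * C₂ / (n : ℝ) ^ q) := by
  have hn0 : (0 : ℝ) < n := by exact_mod_cast (show 0 < n by omega)
  have hC : 0 ≤ C₂ := by
    have h := hrate n (by omega)
    exact le_trans (mul_nonneg (abs_nonneg _) (Real.rpow_nonneg hn0.le q)) h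
  rcases le_total n m with hnm | hmn
  · -- `m = n + t`
    obtain ⟨t, rfl⟩ := Nat.exists_eq_add_of_le hnm
    have h := abs_sub_le_of_steps hq hrate (p := n) (by omega) (by omega) t
    have habs : |(n : ℝ) - ((n + t : ℕ) : ℝ)| = t := by
      push_cast; rw [abs_sub_comm, add_sub_cancel_left, Nat.abs_cast]
    rw [habs]
    refine h.trans (mul_le_mul_of_nonneg_left ?_ (Nat.cast_nonneg t))
    exact div_le_div_of_nonneg_right
      (le_mul_of_one_le_left hC (Real.one_le_rpow (by norm_num) hq)) (Real.rpow_nonneg hn0.le q)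
  · -- `n = m + t`, `m ≥ n/2 ≥ N + 1`
    obtain ⟨t, rfl⟩ := Nat.exists_eq_add_of_le hmn
    have hm0 : (0 : ℝ) < m := by exact_mod_cast (show 0 < m by omega)
    have h := abs_sub_le_of_steps hq hrate (p := m) (by omega) (by omega) t
    have habs : |((m + t : ℕ) : ℝ) - (m : ℝ)| = t := by
      push_cast; rw [add_sub_cancel_left, Nat.abs_cast]
    rw [abs_sub_comm (f (m + t)), habs]
    refine h.trans (mul_le_mul_of_nonneg_left ?_ (Nat.cast_nonneg t))
    -- `C₂ / m^q ≤ 2^q C₂ / (m+t)^q` since `m + t ≤ 2 m`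
    have h2 : ((m + t : ℕ) : ℝ) ^ q ≤ (2 * (m : ℝ)) ^ q :=
      Real.rpow_le_rpow (by positivity) (by exact_mod_cast hm) hq
    rw [Real.mul_rpow (by norm_num) hm0.le] at h2
    rw [div_le_div_iff₀ (Real.rpow_pos_of_pos hm0 q) (by positivity)]
    calc C₂ * ((m + t : ℕ) : ℝ) ^ q ≤ C₂ * (2 ^ q * (m : ℝ) ^ q) := mul_le_mul_of_nonneg_left h2 hC
      _ = 2 ^ q * C₂ * (m : ℝ) ^ q := by ring

/-! ### Final arithmetic of the equicontinuity and tightness clauses -/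

/-- **Equicontinuity arithmetic.** With `r ≤ √3 n`, `|a_x − a_y| n^{p'} ≤ L₁ δ`, `a_y n^{p'} ≤ 32 C₀`
and `|r^{p'} − s^{p'}| ≤ 31 δ r^{p'}`: `|a_x r^{p'} − a_y s^{p'}| ≤ (16 L₁ + 15872 C₀) δ`. -/
theorem equicont_arith {δ n p' r s ax ay L₁ C₀ : ℝ} (hδ : 0 ≤ δ) (hn : 0 < n) (hp0 : 0 ≤ p')
    (hp5 : p' ≤ 5) (hr : 0 ≤ r) (hrn : r ≤ Real.sqrt 3 * n) (hay : 0 ≤ ay)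
    (hD : |ax - ay| * n ^ p' ≤ L₁ * δ) (hayC : ay * n ^ p' ≤ 32 * C₀)
    (hrs : |r ^ p' - s ^ p'| ≤ 31 * δ * r ^ p') :
    |ax * r ^ p' - ay * s ^ p'| ≤ (16 * L₁ + 15872 * C₀) * δ := by
  have hr16 : r ^ p' ≤ 16 * n ^ p' := rpow_le_16_mul hr hn.le hrn hp0 hp5
  have hrp : 0 ≤ r ^ p' := Real.rpow_nonneg hr p'
  have e : ax * r ^ p' - ay * s ^ p' = (ax - ay) * r ^ p' + ay * (r ^ p' - s ^ p') := by ring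
  rw [e]
  calc |(ax - ay) * r ^ p' + ay * (r ^ p' - s ^ p')|
      ≤ |(ax - ay) * r ^ p'| + |ay * (r ^ p' - s ^ p')| := abs_add_le _ _
    _ = |ax - ay| * r ^ p' + ay * |r ^ p' - s ^ p'| := by
        rw [abs_mul, abs_mul, abs_of_nonneg hrp, abs_of_nonneg hay]
    _ ≤ |ax - ay| * (16 * n ^ p') + ay * (31 * δ * (16 * n ^ p')) := by
        refine add_le_add (mul_le_mul_of_nonneg_left hr16 (abs_nonneg _))
          (mul_le_mul_of_nonneg_left (hrs.trans ?_) hay)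
        exact mul_le_mul_of_nonneg_left hr16 (by positivity)
    _ = 16 * (|ax - ay| * n ^ p') + 496 * δ * (ay * n ^ p') := by ring
    _ ≤ 16 * (L₁ * δ) + 496 * δ * (32 * C₀) :=
        add_le_add (mul_le_mul_of_nonneg_left hD (by norm_num))
          (mul_le_mul_of_nonneg_left hayC (by positivity))
    _ = (16 * L₁ + 15872 * C₀) * δ := by ring

/-- **Tightness arithmetic.** With `K = max 2 (128 C₀ / ((3−η) ε c))`, `K n < M + 1` (`n ≥ 1`), a tail
bound `T ≤ 8 C₀ M^{-(3-η)}/(3−η)` and the radial lower bound `c/2 ≤ S n^{3−η}` give `T ≤ ε S`. -/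
theorem tightness_arith {η C₀ c ε n S T : ℝ} {M : ℕ} (hη0 : 0 ≤ η) (hη1 : η < 1) (hC₀ : 0 ≤ C₀)
    (hc : 0 < c) (hε : 0 < ε) (hn : 1 ≤ n)
    (hM2 : max 2 (128 * C₀ / ((3 - η) * ε * c)) * n < M + 1)
    (hT : T ≤ 8 * C₀ * ((((M : ℝ) ^ (3 - η))⁻¹) / (3 - η))) (hS : c / 2 ≤ S * n ^ (3 - η)) :
    T ≤ ε * S := by
  set K := max 2 (128 * C₀ / ((3 - η) * ε * c)) with hK
  have hK2 : 2 ≤ K := le_max_left _ _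
  have hK' : 128 * C₀ / ((3 - η) * ε * c) ≤ K := le_max_right _ _
  have h3η : 0 < 3 - η := by linarith
  have hKn : 2 ≤ K * n := by nlinarith
  have hMge : K * n / 2 ≤ M := by linarith
  have hM0 : 0 < (M : ℝ) := by linarith
  have hnpos : 0 < n ^ (3 - η) := Real.rpow_pos_of_pos (by linarith) _
  have hpow : K * n ^ (3 - η) / 8 ≤ (M : ℝ) ^ (3 - η) := by
    have h1 : (K * n / 2) ^ (3 - η) ≤ (M : ℝ) ^ (3 - η) :=
      Real.rpow_le_rpow (by positivity) hMge h3η.le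
    have h2 : (K * n / 2) ^ (3 - η) = K ^ (3 - η) * n ^ (3 - η) / 2 ^ (3 - η) := by
      rw [Real.div_rpow (by positivity) (by norm_num), Real.mul_rpow (by positivity) (by linarith)]
    have h3 : (2 : ℝ) ^ (3 - η) ≤ 8 := by
      calc (2 : ℝ) ^ (3 - η) ≤ 2 ^ (3 : ℝ) :=
            Real.rpow_le_rpow_of_exponent_le (by norm_num) (by linarith)
        _ = 8 := by norm_num
    have h4 : K ≤ K ^ (3 - η) := by
      calc K = K ^ (1 : ℝ) := (Real.rpow_one K).symm
        _ ≤ K ^ (3 - η) := Real.rpow_le_rpow_of_exponent_le (by linarith) (by linarith)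
    have h28 : (0 : ℝ) < 2 ^ (3 - η) := by positivity
    calc K * n ^ (3 - η) / 8 ≤ K ^ (3 - η) * n ^ (3 - η) / 2 ^ (3 - η) := by
          rw [div_le_div_iff₀ (by norm_num) h28]
          have h5 : K * 2 ^ (3 - η) ≤ K ^ (3 - η) * 8 := mul_le_mul h4 h3 h28.le (by positivity)
          nlinarith [h5, hnpos]
      _ = (K * n / 2) ^ (3 - η) := h2.symm
      _ ≤ (M : ℝ) ^ (3 - η) := h1
  have hMpos : 0 < (M : ℝ) ^ (3 - η) := Real.rpow_pos_of_pos hM0 _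
  have hinv : ((M : ℝ) ^ (3 - η))⁻¹ ≤ 8 / (K * n ^ (3 - η)) := by
    rw [inv_eq_one_div, div_le_div_iff₀ hMpos (by positivity)]
    linarith [hpow]
  have hS' : c / 2 / n ^ (3 - η) ≤ S := by rw [div_le_iff₀ hnpos]; exact hS
  have hKbound : 64 * C₀ / ((3 - η) * K) ≤ ε * c / 2 := by
    rw [div_le_iff₀ (by positivity)]
    have := (div_le_iff₀ (by positivity : 0 < (3 - η) * ε * c)).mp hK'
    nlinarith [this]
  calc T ≤ 8 * C₀ * (((M : ℝ) ^ (3 - η))⁻¹ / (3 - η)) := hT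
    _ ≤ 8 * C₀ * ((8 / (K * n ^ (3 - η))) / (3 - η)) := by gcongr
    _ = 64 * C₀ / ((3 - η) * K) * (1 / n ^ (3 - η)) := by
        field_simp
        ring
    _ ≤ (ε * c / 2) * (1 / n ^ (3 - η)) := mul_le_mul_of_nonneg_right hKbound (by positivity)
    _ = ε * (c / 2 / n ^ (3 - η)) := by ring
    _ ≤ ε * S := mul_le_mul_of_nonneg_left hS' hε.le

/-! ### Registered helper sub-goal -/

/-- **Registered helper sub-goal `stub_scaleRegularity_auxPowers`** of stub `stub_scaleRegularity`
(line `self-energy-pick-inversion`, crux stmt-CriticalPhenomena-4799): POWERS OF COMPARABLE LENGTHS —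
`|r − s| ≤ δ r`, `0 ≤ δ ≤ 1/2`, `0 ≤ p' ≤ 5` give `|r^{p'} − s^{p'}| ≤ 31 δ r^{p'}` (the step
`| |x|^{5−η} − |y|^{5−η} | ≤ C δ |x|^{5−η}` of the equicontinuity clause (R2)). -/
theorem stub_scaleRegularity_auxPowers :
    ∀ r s δ p' : ℝ, 0 ≤ r → 0 ≤ s → 0 ≤ δ → δ ≤ 1 / 2 → 0 ≤ p' → p' ≤ 5 → |r - s| ≤ δ * r →
    |r ^ p' - s ^ p'| ≤ 31 * δ * r ^ p' :=
  fun _r _s _δ _p' hr hs hδ0 hδ hp0 hp5 hrs => abs_rpow_sub_rpow_le hr hs hδ0 hδ hp0 hp5 hrs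

end Summit.CriticalPhenomena.Ising3DConformalLimit.Cruxes.DirectCorrelationStableTail.SelfEnergyPickInversion

end
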